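import Summits.PneNP.PneNP.Theorems.ExpanderLinearGeneratorsNoPolyBoundedProofSystemQuarterPad
import Summits.PneNP.PneNP.Theorems.ExpanderLinearGeneratorsNoPolyBoundedProofSystemQuarterScale
import Literature.Computability.Complexity.SparseSetsUpwardSeparationNE
import Literature.Computability.Complexity.PHCollapseNP

/-!
# Route ExpanderLinearGenerators — target `NoPolyBoundedProofSystem` (stmt-PneNP-0097), line `Sketch`:
# the BOOTSTRAP — `NP = coNP` manufactures an exponentially hard language in `NE ∩ coNE`

Helper file for the crux `X := ¬ HasPolyBoundedProofSystem TAUT` (≡ `NP ≠ coNP`,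
`noPolyBoundedProofSystem_iff_NP_ne_coNP`), bootstrap composition of the line `Sketch`
(`Cruxes/ProofcplxThesis/Lines/Sketch.lean`, idea card `collapse-feeds-generator`): Krajíček's
observation (Fund. Math. 182 (2004), Thm. 3.1(ii); worst-case form, via Kannan 1982) that INSIDE the
reductio `¬X`, i.e. `NP = coNP`, the polynomial hierarchy collapses and the least hard truth table
becomes an `NP ∩ coNP` object, so that an exponentially hard language lies in `NE ∩ coNE`:

* `kannan_lang_mem_NP_of_NP_eq_coNP` — under `NP = coNP`, Kannan's `Σ₄ᵖ` diagonal language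
  `Kannan.lang 0` and its complement are in `NP` (Stockmeyer collapse `PH_eq_NP_of_NP_eq_coNP`);
* `hardLanguageInNEcoNE_of_NP_eq_coNP` — **bootstrap hardness**: `NP = coNP` ⇒ some `L` with
  `L ∈ NE`, `Lᶜ ∈ NE` and `circuitSize L n ≥ 2^{n/8}` for all large `n`. The language is the scaled
  Kannan diagonal language `KannanScaled.diag N` (`ScaledKannanDiagonal.lean`) at the
  quarter-exponential scale `N(n) = 2^{⌊⌊n/2⌋/2⌋+2} + ⌊⌊n/2⌋/2⌋ + 3`: it is the preimage of
  `Kannan.lang 0` under the padding `y ↦ y0^{N(|y|)-|y|}`, which is computable in time `2^{O(n)}`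
  (`quarterPad_mem_FE`, Theorems …QuarterPad), so it and its complement are `NP`-preimages under an
  `FE` map, hence in `NE` (`preimage_mem_NE_of_mem_FE`, Hartmanis–Immerman–Sewelson upward
  translation); the lower bound is `eventually_le_circuitSize_diag_quarter` (Theorems …QuarterScale,
  from `KannanScaled.lt_circuitSize_diag`);
* `hardLanguageInNEcoNE_of_not_noPolyBoundedProofSystem` — the same read through the target.

With this file the line's skeleton closes the crux modulo ONE registered stub,
`conditionalGenerator_of_hardLanguage` (hard language in `NE ∩ coNE` ⇒ a stretching map with `NP`
range and no polynomially bounded proof system for its range complement), which is kernel-equivalent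
to "hard language ⇒ X" (analysis file of the line).

Sources: J. Krajíček, *Diagonalization in proof complexity*, Fund. Math. 182 (2004) 181–192,
Thm. 3.1(ii); R. Kannan, *Circuit-size lower bounds and non-reducibility to sparse sets*, Inform.
Control 55 (1982), Lemma 1; J. Hartmanis, N. Immerman, V. Sewelson, Inform. Control 65 (1985), Thm. 1
(proof); L. Stockmeyer, TCS 3 (1976) (collapse).
-/

set_option linter.dupNamespace false -- `Summit.PneNP.PneNP.…`: summit = sub-problem name (D-0017 single-conjunct layout)

namespace Summit.PneNP.PneNP.Theorems.Bootstrap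

open Filter
open Literature.Computability.Complexity Literature.Computability.MetaComplexity
open Summit.PneNP.PneNP.Theses

/-! ### The bootstrap (Krajíček 2004, Thm. 3.1(ii), worst-case form) -/

/-- Under `NP = coNP`, Kannan's `Σ₄ᵖ` diagonal language and its complement are in `NP`
(Stockmeyer collapse `PH = NP`). [cite: Kannan1982, Lemma 1] -/
theorem kannan_lang_mem_NP_of_NP_eq_coNP (hNC : Nondeterministic.NP = coNP) :
    Kannan.lang 0 ∈ Nondeterministic.NP ∧ (Kannan.lang 0)ᶜ ∈ Nondeterministic.NP := by
  have h1 : Kannan.lang 0 ∈ Nondeterministic.NP := by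
    rw [← PH_eq_NP_of_NP_eq_coNP hNC]
    exact SigmaP_subset_PH 4 (Kannan.lang_mem_SigmaP_four 0)
  refine ⟨h1, ?_⟩
  have h2 : Kannan.lang 0 ∈ coNP := hNC ▸ h1
  exact h2

/-- **Bootstrap hardness.** If `NP = coNP` then some language in `NE ∩ coNE` has circuit
complexity `≥ 2^{n/8}` at every large length (the scaled Kannan diagonal language).
[cite: Kannan1982, Lemma 1] -/
theorem hardLanguageInNEcoNE_of_NP_eq_coNP (hNC : Nondeterministic.NP = coNP) :
    ∃ L : Language Bool, L ∈ NE ∧ Lᶜ ∈ NE ∧ ∃ δ : ℝ, 0 < δ ∧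
      ∀ᶠ n : ℕ in atTop, (2 : ℝ) ^ (δ * n) ≤ (L.circuitSize n : ℝ) := by
  set N : ℕ → ℕ := fun n => 2 ^ (n / 2 / 2 + 2) + (n / 2 / 2 + 2) + 1 with hN
  have hset : KannanScaled.diag N =
      (fun y : List Bool => Kannan.pad (2 ^ (y.length / 2 / 2 + 2) + (y.length / 2 / 2 + 2) + 1) y) ⁻¹'
        Kannan.lang 0 := rfl
  obtain ⟨h1, h2⟩ := kannan_lang_mem_NP_of_NP_eq_coNP hNC
  refine ⟨KannanScaled.diag N, ?_, ?_, 1 / 8, by norm_num, eventually_le_circuitSize_diag_quarter⟩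
  · rw [hset]
    exact preimage_mem_NE_of_mem_FE h1 quarterPad_mem_FE
  · rw [hset]
    exact preimage_mem_NE_of_mem_FE h2 quarterPad_mem_FE

/-- The bootstrap read through the target: if `NoPolyBoundedProofSystem` FAILS then some language in
`NE ∩ coNE` has circuit complexity `≥ 2^{n/8}` at every large length. [cite: Kannan1982, Lemma 1] -/
theorem hardLanguageInNEcoNE_of_not_noPolyBoundedProofSystem
    (hX : ¬ ExpanderLinearGenerators.NoPolyBoundedProofSystem) :
    ∃ L : Language Bool, L ∈ NE ∧ Lᶜ ∈ NE ∧ ∃ δ : ℝ, 0 < δ ∧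
      ∀ᶠ n : ℕ in atTop, (2 : ℝ) ^ (δ * n) ≤ (L.circuitSize n : ℝ) := by
  have hNC : Nondeterministic.NP = coNP := by
    by_contra h
    exact hX (noPolyBoundedProofSystem_iff_NP_ne_coNP.2 h)
  exact hardLanguageInNEcoNE_of_NP_eq_coNP hNC

end Summit.PneNP.PneNP.Theorems.Bootstrap
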